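import Mathlib
import HarnessLib
import HarnessLib.Audit
import Summits.KontsevichZagierPeriods.Statement
import Literature.NumberTheory.Transcendental.MZVSimplexRepProofs
import Literature.NumberTheory.Transcendental.KZRelationsLE

/-!
Route: LinRedNormalForm

DORMANT since 2026-09-04T17:28:00Z (reconciler: no traction for 5 d (last activity statement-checked at 2026-08-30T16:55:56Z); parked, not closed — `ledger route dormant route-KontsevichZagierPeriods-LinRedNormalForm --off` to reactivat) — unstaffed, not closed; items shared with open routes are served there. `ledger route dormant <id> --off` reactivates.

Thesis (idea card KontsevichZagierPeriods/KontsevichZagierPeriods/linear-reducibility-normal-form).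
LINEAR REDUCIBILITY IS A KZ NORMAL FORM. Read with every hyperlogarithm kept UNFOLDED (a word of
depth d = d extra simplex variables), each step of the Brown–Panzer fibrewise integration of a
linearly reducible rational integrand is an instance of KZ's rules: partial fractions = integrand
additivity (1b); shuffles = domain additivity (1a); coordinate changes on M_{0,n}, compactifications
x ↦ x/(1−x), blow-ups = change of variables (2); and the primitive/evaluation step ∫_t^1 ∂_y
c(x,y)·G dy = [c·G]_t^1 is ONE Newton–Leibniz move (3) whose primitive c(x,y)·∏(tᵢ − aᵢ(x))⁻¹ is
ALGEBRAIC because the transcendental part G is carried by the extra variables. The only step that is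
not a rule is the integrator's `∞ − ∞`: regularised limits at colliding letters. It suffices to show
X = (genus-zero normal form) ∧ (kernel on normal forms) ∧ (declared residual):
(NF) DihedralNormalForm — every absolutely convergent rational representation on an open ordered
simplex {1 > t₀ > … > t_{k−1} > 0} whose integrand is a regular top form on M_{0,k+3}, P(t)/(∏
tᵢ^{bᵢ} ∏ (1−tᵢ)^{cᵢ} ∏_{i<j} (tᵢ−tⱼ)^{aᵢⱼ}), is KZ-equivalent to a ℤ-combination of MZV word
representations [Δ_w, q·∏ ω_{εᵢ}(tᵢ)], q ∈ ℚ (value-level shadow: Brown's theorem that periods of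
M_{0,n} are MZVs, BrownENS2009 Thm 1.1 — here demanded as a chain of moves with absolutely
convergent intermediates);
(KER) MzvKernelInKZ — every vanishing ℤ-combination of MZV word representations lies in KZ.relations
— SCOPED TO MOTIVIC RELATIONS (route-repair 2026-08-16): `closes` no longer assumes KER but DERIVES
it from (KER-M) HoffmanSpanInKZ — every MZV word generator [Δ_w, q·∏ω_ε] is ≡ mod KZ.relations to a
ℤ-combination of Hoffman generators [Δ_w, q'·ω_u], u ∈ {2,3}^× (Brown2012 Thm 1.1: these Hoffman
expansions are MOTIVIC relations; the attackable, transcendence-free side) — and (KER-T)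
HoffmanIndependence — the real Hoffman values are ℚ-linearly independent (the NAMED transcendence
input = Zagier's conjecture in Brown's basis; declared, not attacked);
(RES) ResidualBeyondGenusZero — every vanishing formal combination is congruent modulo KZ.relations
to a combination of genus-zero representations (the complement of the sector, NOT attacked here; it
is what routes NoriTransfer / Grothendieck / AyoubSpecialisation and the genus-one card address).
NF ∧ KER give Conjecture 1 on the genus-zero sector unconditionally in RES (item SectorGlue →
GenusZeroSector); the envelope beyond M_{0,n} is probed by two typed cruxes — WheelThreeSpokes (the
first Feynman period, [ℝ₊⁵, 1/Ψ_{K₄}²] ~ 6·ζ(3)-simplex) and ArrangementNormalForm (cells of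
rational hyperplane arrangements ↦ hyperlogarithm word reps with rational letters) — which carry the
card's ConvergentReduction crux in typed form.
Lean (target GenusZeroSector): ∀ (k k' : ℕ) (r :
Literature.NumberTheory.Transcendental.KZ.IntegralRep k) (r' :
Literature.NumberTheory.Transcendental.KZ.IntegralRep k') …(genus-zero integrand data)…, r.value =
r'.value → Literature.NumberTheory.Transcendental.KZ.Equivalent r r'  (full one-line term in the
item; elaborates, Sketch.lean rc 0).
Lean (Assembly): DihedralNormalForm → MzvKernelInKZ → ResidualBeyondGenusZero →
KontsevichZagierPeriods  (provable now: closure induction, soundness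
Literature.NumberTheory.Transcendental.KZ.relations_le_ker_eval_holds, and kernel form ⇒ statement
as in Theorems/KernelFormKernelImpliesStatement.lean).
Lean (closes, 2026-08-16): DihedralNormalForm → HoffmanSpanInKZ → HoffmanIndependence →
ResidualBeyondGenusZero → KontsevichZagierPeriods (sorry-free, standard axioms; derives
MzvKernelInKZ first, then the Assembly argument).
## Assembly
c ∈ ker eval ⇒ (RES) c ≡ c₀ ∈ span(genus-zero reps) mod relations, eval c₀ = 0 by soundness ⇒ (NF,
extended additively over AddSubgroup.closure) c₀ ≡ m ∈ span(MZV word reps), eval m = 0 ⇒ (KER) m ∈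
relations ⇒ c ∈ relations ⇒ KZKernelConjecture ⇒ KontsevichZagierPeriods. KER itself: m ≡ h ∈
span(Hoffman reps [Δ, q·ω_u]) by KER-M extended additively; modulo relations h = Σ_u cls[Δ,
l(u)·ω_u] with l finitely supported (q ↦ cls[Δ, q·ω_u] is additive by integrand additivity); eval h
= Σ_u l(u)·ζ(u) (KZ.mzvRep_value_holds) = 0 ⇒ l = 0 by KER-T ⇒ h, m ∈ relations. The inlined simplex
{t | (∀ i, 0 < t i) ∧ (∀ i, t i < 1) ∧ StrictAnti t} and letters `if ε then 1/(1−t) else 1/t` are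
definitionally Literature.NumberTheory.Transcendental.KZ.openOrderedSimplex / KZ.mzvForm (rfl), so
Literature.NumberTheory.Transcendental.KZ.mzvRep instances are covered.

Rationale: WHY THIS LINE. Linear reducibility (Brown2009; compatibility-graph form Panzer2015,
PanzerThesis2015) is the decidable syntactic condition under which a rational integrand can be
integrated out one variable at a time inside hyperlogarithms with rational letters; geometrically
each step is a fibration of genus-zero moduli spaces (BrownENS2009, BognerBrown2015). Imported area:
the symbolic-integration theory of Feynman periods (HyperInt) and the geometry of M_{0,n}; the
dictionary is literal — printed in UNFOLDED variables a run of the integrator is a list of rule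
instances, the primitive of every Newton–Leibniz step being algebraic because the hyperlogarithm
rides along as extra simplex variables (this is the catalogued evasion "add variables" of the
primitives barrier, made systematic). What no source does is keep the intermediates ABSOLUTELY
CONVERGENT: Brown's and Panzer's procedures take regularised limits (tangential base points;
DupontPanzerPym2026 geometrises them as log corners), which the fixed calculus forbids. The route
therefore states the normal form as a theorem INSIDE the calculus on the cleanest classes where the
value statement is already a theorem (M_{0,n}: BrownENS2009 Thm 1.1; arrangements:
Brown2009/Panzer2015) and isolates the convergence of the reduction as the crux; the kernel side
reuses the MZV motivic picture (Zagier1994, Brown2012, IharaKanekoZagier2006, BrownCarrSchneps2010,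
Souderes2010). Conjecture 1 for this sector is otherwise attacked only through GPC/Nori transfer
(routes Grothendieck, NoriTransfer), where nothing is typed below the associator level.
RANKED CRUXES. #2 DihedralNormalForm — genus-zero reps ↦ ℤ-combinations of MZV word reps by moves
(why it might fail: at corners of M̄_{0,n} several letters collide with endpoints at once and paired
counterterms may not keep every intermediate absolutely convergent — Neg pressure point (a); sources
BrownENS2009, BognerBrown2015, Panzer2015). #3 WheelThreeSpokes — [ℝ₊⁵, 1/Ψ_{K₄}²] ~ [Δ₃,
6/(t₀t₁(1−t₂))] (why: every published evaluation of P(K₄) = 6ζ(3) leaves the calculus — Gegenbauer,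
HyperInt reglim at 0/∞, graphical functions, BEK; sources BroadhurstKreimer1995, Schnetz2010,
BlochEsnaultKreimer2006, Brown2009FeynmanPeriods). #4 MzvKernelInKZ — vanishing ℤ-combinations of
MZV word reps are KZ relations (why: characterising the kernel needs Zagier's conjecture, open, and
quasi-shuffle/associator relations may be unreachable with convergent intermediates; sources
Zagier1994, Brown2012, IharaKanekoZagier2006, BrownCarrSchneps2010) — SCOPED 2026-08-16:
transcendence-complete as stated (Negative/Transfer.lean `zeta_three_not_mem_span_of_crux`), so it
is NO LONGER A HYPOTHESIS OF `closes` but is DERIVED inside it from #6 ∧ #7; kept as the staffed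
umbrella of the two-posets line (Cruxes/MzvKernelInKZ), whose unconditional output is #6. #5
ArrangementNormalForm — convergent P/∏Lⱼ^{eⱼ} on an open rational polyhedral cell ↦ ℤ-combination of
hyperlogarithm word reps [Δ_w, q∏(tᵢ−aᵢ)⁻¹], aᵢ ∈ ℚ (why: the simplest infinite linearly reducible
family beyond the braid arrangement; same convergence obstruction plus letters landing in (0,1)
after rescaling; sources Brown2009, Panzer2015; feeds the closes hypothesis DihedralNormalForm
through the glue item ArrangementSectorGlue with the supports HyperlogKernelInKZ and
GenusZeroValuesMzv — route-repair 2026-08-16). #6 HoffmanSpanInKZ — THE MOTIVIC SIDE OF THE KERNEL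
(route-repair 2026-08-16, judge: scope MzvKernelInKZ to motivic relations): every MZV word generator
[Δ_w, q·∏ω_ε] is ≡ mod KZ.relations to a ℤ-combination of Hoffman generators [Δ_w, q'·ω_u], u ∈
{2,3}^×, |u| = w (Brown2012 Thm 1.1/7.4: the Hoffman expansions ζᵐ(ε) = Σ c_u ζᵐ(u) are MOTIVIC
relations; the item demands them, and nothing transcendental, as move chains; WHY EASIER than #4: a
spanning statement proved weight by weight from an explicit list of identities between convergent
integrals — duality (one move, landed), finite double shuffle (shuffle = dissection via
KZ.of_mul_of; stuffle = Soudères' positive cubical partial fractions), Hoffman's relation through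
convergent avatars (FurushoPentagon.HoffmanRelationInKZ), EDS certificates decidable per weight —
instead of a kernel statement containing open irrationality questions) (why it might fail: rules may
be weaker than motives, HuberMullerStachPeriods2017 Rem 13.1.8 — regularised relations may lack
convergent move chains, and EDS-completeness, IKZ2006 Conj. 1, is open beyond computer-checked
weights; sources Brown2012, arXiv:1102.1310, Hoffman1997, IharaKanekoZagier2006, Souderes2010; ⇐
CoactionDevissage.HoffmanSpan stmt-3166 by KZ.scale + Divergence.lean; = calculus half + EdsComplete
of the two-posets line). #7 HoffmanIndependence — the DECLARED TRANSCENDENCE INPUT (named hypothesis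
of `closes`, not attacked): the real Hoffman values ζ(u), u ∈ {2,3}^×, are ℚ-linearly independent; ⟺
ZagierConjecture given hoffmanSpan_eq_mzvSpace (Zagier1994 §9, GoncharovECM2001 Conj. 1.1,
Brown2012) = injectivity of the period map on motivic MZVs (why it might fail: Zagier-conjecture
strength, unprovable and unkillable by present transcendence methods — even ζ(5) ∉ ℚ·ζ(2)ζ(3) is
open; sources Zagier1994, Brown2012, GoncharovECM2001). #8 ResidualBeyondGenusZero — the DECLARED
COMPLEMENT of the sector, now a crux (route-repair 2026-08-16, D-0027 §2.2: every hypothesis of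
`closes` is a crux; a sector route lists its complement): every vanishing formal combination is ≡
mod KZ.relations to a ℤ-combination of genus-zero reps (why it might fail: summit strength off the
sector — S ⇐ KZKernelConjecture and nothing weaker is known
(Theorems/LinRedNormalFormResidualBeyondGenusZero{Strength,Forms,OneRep}.lean, p77321/p79892/p81612:
S ↔ ‘every single representation of 0 is genus-zero mod moves’ ↔ eval⁻¹(eval⟨GZ⟩) = relations ⊔
⟨GZ⟩); false as soon as one vanishing combination with an elliptic or Γ-value member has no move
chain into genus zero; sources KontsevichZagier2001, HuberMullerStachPeriods2017, Ayoub2015,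
CressonViusos2022). WHY THIS FORM: it is NOT claimed easier than Conjecture 1 off the sector and is
not attacked from this route (held; ranked last); it is strictly weaker than the summit only by the
genus-zero kernel, which is exactly what cruxes #2–#5 carry, and it is the splice point where
further sector counts (genus-one iterated integrals, Γ-corners — routes GenusOneIterated,
Grothendieck, AyoubSpecialisation, FurushoPentagon.SectorToKernel) attach by glued splits RES ⇐
(next sector normal form) → (next sector kernel) → (smaller residual).
KILL CRITERIA. (1) An additive invariant ι : KZ.FormalRep →+ A vanishing on the four move sets and
separating the WheelThreeSpokes pair or a genus-zero pair refutes the item AND the summit (template: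
route Neg item NegObstructionShape) — route closed, card outcome refuted, the witness handed to Neg.
(2) A proof that some convergent genus-zero rep admits NO move chain to MZV word reps with
convergent intermediates (e.g. via a definability/convergence invariant finer than the value)
refutes DihedralNormalForm: pivot to "sector-decomposed normal form" (blow-ups first) or close
exhausted with census. (3) HyperInt evidence (CHEAPEST FALSIFIER) that every linearly reducible
order for K₄ calls reglim on divergent words with no rational pairing demotes WheelThreeSpokes to
Neg's sharpest regularisation witness and rescopes ArrangementNormalForm. (4) For the scoped kernel:
an exact-rank computation showing that duality + finite double shuffle + Hoffman relation vectors do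
NOT cut the formal word space of some weight N down to d_N Hoffman coordinates (IKZ Conj. 1 failing
in weight N) kills the two-posets engine for HoffmanSpanInKZ in that weight (the crux then survives
only through other motivic families — associator/confluence relations); a proof that Hoffman's
relation for s = (3) (ζ(4) = ζ(3,1) + ζ(2,2)) has no move chain with absolutely convergent
intermediates refutes HoffmanSpanInKZ at weight 4, and with it the only engine for MzvKernelInKZ.
HoffmanIndependence (like ResidualBeyondGenusZero) is declared and deliberately not a kill target:
its negation would be a sensational transcendence theorem sinking Zagier's conjecture and
MzvKernelInKZ alike.
NOT DECOMPOSED YET. The general envelope LinRedKZ (all linearly reducible integrands; needs the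
definition LinearlyReducible — requested) and its letters {0, ±1} (alternating sums); (the split of
MzvKernelInKZ into transcendence input + motivic move chains is DONE as the scoping #6/#7,
2026-08-16; what stays undecomposed is HoffmanSpanInKZ by weight — its rungs (weight ≤ 3 congruence
+ duality; weight 4 FDS + Hoffman s = (3); weight N EDS certificates) are stubs of the two-posets
line, not items, and the alternative generating families (Goncharov–Manin cell-zeta/forgetful-map
relations, BrownCarrSchneps2010; associator relations, route FurushoPentagon) are Approaches of #6,
not new items); the split of DihedralNormalForm by depth/weight (depth 1 = BeukersZeta3-type, then
corners of codimension 2); sector decomposition (Bogner–Weinzierl blow-ups) as a move package; a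
trace→certificate translator for HyperInt logs. All wait for a crux to close (D-0019).
CHEAPEST FALSIFIER. kit: run HyperInt on the parametric integrand 1/Ψ_{K₄}² (affine chart α₃₄ = 1)
in each linearly reducible order, logging every `reglim`/regularised-limit call on a divergent word;
repeat on the sector-decomposed pieces. One clean order = a candidate move certificate for
WheelThreeSpokes; none = evidence against the convergence crux at dimension 5. Cheaper still for
DihedralNormalForm: the depth-one case ∫_{Δ₂} P(t₀,t₁)/(t₀^b(1−t₁)^c(t₀−t₁)^a) by hand — every step
must avoid splitting (c(1)−c(t))/t.
TWO-LAYER PLAN. Foreseen glued splits (k ≤ 3, after a close): DihedralNormalForm ⇐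
(UnfoldedPrimitiveStep: the paired Newton–Leibniz identity [band, ∂_y c·ρ] − [base, (c(·,1) −
c(·,t₁))·ρ] ∈ relations) → (CornerPairing: codimension-2 collisions) → DihedralNormalForm;
MzvKernelInKZ ⇐ HoffmanSpanInKZ → HoffmanIndependence → MzvKernelInKZ (REALISED 2026-08-16 as the
scoping: antecedents = items #6/#7, glue PROVED inside `closes` — closure induction to a finitely
supported normal form over Hoffman indices via additivity of q ↦ [Δ, q·ω_u], evaluation by
KZ.mzvRep_value_holds, coefficients killed by independence; Theorems-level twin
Negative/Transfer.lean `cruxAdm_of_family`); GenusZeroSector ⇐ SectorGlue (filed);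
DihedralNormalForm ⇐ ArrangementSectorGlue: ArrangementNormalForm → HyperlogKernelInKZ →
GenusZeroValuesMzv → DihedralNormalForm (filed 2026-08-16: analytic half = the arrangement normal
form with free rational letters on the braid cell, arithmetic half = the hyperlogarithm-letter
kernel, value input = Brown's theorem; this is how crux #5 enters the cone of `closes`).
SUPPORT. SectorGlue (DihedralNormalForm → MzvKernelInKZ → GenusZeroSector; provable now: closure
induction + relations_le_ker_eval_holds); BeukersZeta3 ([(0,1)³, 1/(1−(1−xy)z)] ~ [Δ₃,
2/(t₀t₁(1−t₂))], ≈ 6 moves: CoV u = 1−(1−xy)z, domain additivity of {xy<u<1}, CoV u = xv, symmetry,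
cube→simplex; provable now, calibrates the unfolded engine at depth 1); (ResidualBeyondGenusZero
moved to RANKED CRUXES #6, 2026-08-16.) HyperlogKernelInKZ (declared sector kernel on hyperlogarithm
word reps with rational letters — the arrangement-sector analogue of MzvKernelInKZ, which is its
letters-{0,1} sub-case; summit-strength on its sector, not to be attempted directly; sources
arXiv:math/0103059, DeligneGoncharov2005, Brown2012); GenusZeroValuesMzv (BrownENS2009 Thm 1.1 typed
at value level: a convergent genus-zero rep has the value of a ℤ-combination of MZV word reps; known
result, cite-level, implied by DihedralNormalForm via soundness); ArrangementSectorGlue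
(ArrangementNormalForm → HyperlogKernelInKZ → GenusZeroValuesMzv → DihedralNormalForm; PROVED
sorry-free in the planner's Sketch.lean attached as candidate proof on the item — simplex =
polyhedral cell and braid integrand = P/∏Lⱼ^{eⱼ} matching, closure_mono MZV words ⊆ hyperlog words,
soundness, kernel; to be landed under Theorems/ by a prover).
DEFINITION REQUESTS. LinearlyReducible (Brown2009 Def. of Fubini/linear reducibility of a set of
polynomials w.r.t. an order; Panzer2015 §compatibility graph) under
Literature/NumberTheory/Transcendental — needed to type the envelope LinRedKZ;
KZ.mzvRep/openOrderedSimplex/mzvForm already exist (MZVSimplexRep.lean) and are inlined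
definitionally here.
NUMBERS. P(K₄) = 6ζ(3) = 7.21234141896; local Monte-Carlo of the typed integrand ∫_{ℝ₊⁵}
dα/Ψ_{K₄}(α,1)² = 7.13 ± 0.09 (1.2·10⁷ samples); Beukers n = 0: ∫_{(0,1)³} dxdydz/(1−(1−xy)z) =
2.4013 ± 0.004 vs 2ζ(3) = 2.40411; Ψ_{K₄} = sum over the 16 spanning-tree complements of K₄ (all
3-subsets of the 6 edges except the 4 vertex stars).
SOURCES. KontsevichZagier2001 §1.1–1.2, §3; Hoffman1997; arXiv:1102.1310; BrownENS2009; Brown2009;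
Brown2009FeynmanPeriods; Panzer2015; PanzerThesis2015; BognerBrown2015; BlochEsnaultKreimer2006;
BroadhurstKreimer1995; Schnetz2010; BrownCarrSchneps2010; Souderes2010; IharaKanekoZagier2006;
Zagier1994; Brown2012; GoncharovECM2001; Terasoma2002; DupontPanzerPym2026; ViuSos2021;
CressonViusos2022; lit:book:marcolli2009-feynman-motives p129 (§3.11: wheels ↦ ζ(2n−3)); tree:
Theses/Grothendieck.lean (GpcZeta4Eq4zeta31, stmt-…-0275/0277), Theses/Neg.lean (pressure point (a),
NegObstructionShape), MZVSimplexRep.lean.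

Novelty: Searches run (2026-08-15): lit frontier KontsevichZagierPeriods --since 2018 (30 descendants;
relevant: DupontPanzerPym2026 doi:10.5802/jep.335 regularised integrals/log corners,
arXiv:2601.00346 cellular integrals, arXiv:2503.02096 zeta generators); lit search --hybrid
"linearly reducible hyperlogarithms Feynman integral" / "multiple zeta values periods moduli space
genus zero curves cell" / "regularized limits divergent iterated integrals shuffle regularization
tangential base point" / "wheel with three spokes 6 zeta(3) Feynman period graph polynomial" (held
hits: lit:book:marcolli2009-feynman-motives p129 §3.11,
lit:book:badger2024-scattering-amplitudes-quantum-field-theory p182); lit vsearch "period conjecture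
of Kontsevich–Zagier holds for multiple zeta values … convergent integrals" (no hit on topic); lit
galaxy search "linearly reducible" --star all (Weinzierl, Feynman Integrals, panama:499968552992833:
chapter on linearly reducible integrals; Bogner MPL manual pdf:9035217365964197200) and
"Kontsevich-Zagier" --star pdf (HMS Part III draft, Glanois thesis, Tapušković arXiv:1911.01540 —
none on rules-level proofs); remote OpenAlex/S2/arXiv were rate-limited (429) this session, Crossref
used for citations.
Nearest prior art FOUND. (i) BrownENS2009 (doi:10.24033/asens.2099): periods of M_{0,n} are
ℚ-combinations of MZVs — the VALUE-level form of crux DihedralNormalForm, proved with regularised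
restrictions to boundary divisors; (ii) Brown2009 (doi:10.1007/s00220-009-0740-  [refs: 10.5802/jep.335, 10.24033/asens.2099, 10.1007/s00220-009-0740-5, 10.1016/j.cpc.2014.10.019, 2601.00346, 2503.02096, 1911.01540, 1506.07243, 1408.1862, 1509.01097, doi:10.5802/jep.335, book:marcolli2009-feynman-motives, book:badger2024-scattering-amplitudes-quantum-field-theory, doi:10.24033/asens.2099, doi:10.1007/s00220-009-0740-5, doi:10.1016/j.cpc.2014.10.019, DupontPanzerPym2026, BrownENS2009,]

Barriers (technique_class: variable-elimination; hyperlog-normal-form; unfolding): - technique_class: variable-elimination; hyperlog-normal-form; unfolding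
- Literature.Barriers.KontsevichZagierPeriods.noSemialgebraicPrimitive_inv_sub_two: MET HEAD-ON
(variables ARE eliminated one at a time by fibrewise Newton–Leibniz) and evaded exactly by the
barrier's own catalogued evasion "add variables", made systematic: the would-be transcendental
primitive (a hyperlogarithm, e.g. log(2−t) for 1/(t−2)) is never used as F; it is carried UNFOLDED
as extra simplex variables, and the primitive of each move is the algebraic function
c(x,y)·∏(tᵢ−aᵢ(x))⁻¹ on the band t₁ ≤ y ≤ 1; the number of variables is not fixed in advance (a
depth-d word costs d dimensions), so Ayoub's fixed-number-of-variables heuristic does not apply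
either.
- Literature.Barriers.KontsevichZagierPeriods.cressonViuSos_prop_3_2: not met — the line dissects
throughout (domain additivity for shuffles and pairings, integrand additivity for partial
fractions); no claim of a single global change of variables between two representations is made.
- Literature.Barriers.KontsevichZagierPeriods.not_complete_of_undecidable: compatible, and the line
lives in an "evasions_known"-type sector: on genus-zero / linearly reducible inputs
DihedralNormalForm + Brown's decomposition algorithm for motivic MZVs would make KZ.Equivalent
decidable RELATIVE to the MZV kernel (Zagier's conjecture), which is consistent with the conditional
barrier (no undecidability is known for MZV equality; the barrier needs an undecidability th

Novelty grade: new-combination — ROUTE REVIEW (refuter, 2026-08-15). VERDICT: sound, released — 9/9 items elaborate (W1.lean rc0), all stamped with briefings; SectorGlue 3916 + Assembly 3919 PROVED sorry-free (R1Glue.lean attached as evidence, prover to land). Precision: inlined simplex/letters rfl-equal to KZ.openOrderedSimplex/mz (refuter refuter-rreview-route-KontsevichZagierPe-1621807a-0, 2026-08-15T13:39:19Z; prior: doi:10.24033/asens.2099 (BrownENS2009: periods of M_{0,n} are MZVs = value-level DihedralNormalForm), doi:10.1007/s00220-009-0740-5 (Brown2009 linear reducibility), doi:10.1016/j.cpc.2014.10.019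 (Panzer2015 HyperInt), ViuSos2021 (semi-canonical reduction inside the KZ rules: the only rules-level normal form in print), doi:10.5802/jep.335 (DupontPanzerPym2026, regularised integrals / log corners))

History (route lifecycle, newest last):
- 2026-08-24T06:34:13Z · DORMANT — reconciler: no traction for 6.6 d (last activity item-evidence-added at 2026-08-17T16:13:23Z); parked, not closed — `ledger route dormant route-KontsevichZagier (operator:999:3730840)
- 2026-08-30T09:18:47Z · REACTIVATED — reconciler: reactivated — activity item-evidence-added at 2026-08-30T08:04:38Z after parking at 2026-08-24T06:34:13Z (operator:999:1153549)
- 2026-09-04T17:28:00Z · DORMANT — reconciler: no traction for 5 d (last activity statement-checked at 2026-08-30T16:55:56Z); parked, not closed — `ledger route dormant route-KontsevichZagierPeri (operator:999:1483205)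

sub-problem: KontsevichZagierPeriods · status: dormant · opened planner-plancard-KontsevichZagierPeriods-Kont-a15e0614-0 2026-08-15T11:26:04Z · rev 8 · ledger route-KontsevichZagierPeriods-LinRedNormalForm
GENERATED by the gate from the ledger (D-0016/17). Provers cite these decls: `theorem foo : Summit.KontsevichZagierPeriods.KontsevichZagierPeriods.Theses.LinRedNormalForm.<Decl> := …` in Summits/KontsevichZagierPeriods/KontsevichZagierPeriods/Theorems/<Name>.lean.
-/

namespace Summit.KontsevichZagierPeriods.KontsevichZagierPeriods.Theses.LinRedNormalForm

open scoped BigOperators Topology Manifold Classical MeasureTheory ProbabilityTheory Matrix InnerProductSpace ComplexConjugate ContinuousMap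
open Filter Set Function TopologicalSpace MeasureTheory

attribute [summit_statement] _root_.KontsevichZagierPeriods

open Literature Periods

/-- item stmt-KontsevichZagierPeriods-3911 · target · rank 0 · open · by planner
why it might fail: Needs both halves: a convergent-intermediate normal form (DihedralNormalForm may fail at corners of M̄_{0,n}) and the MZV kernel (transcendence input Zagier's conjecture, open); an additive invariant separating one genus-zero pair kills it and the summit.
sources: BrownENS2009, BrownCarrSchneps2010, KontsevichZagier2001, Zagier1994
[target] Conjecture 1 on the GENUS-ZERO (dihedral / M_{0,n}) sector: two rational integral
representations on open ordered simplices {1 > t₀ > … > t_{k−1} > 0} (definitionally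
KZ.openOrderedSimplex, inlined) whose integrands are regular top forms on M_{0,k+3} — P(t)/(∏
tᵢ^{bᵢ} ∏ (1−tᵢ)^{cᵢ} ∏_{i<j}(tᵢ−tⱼ)^{aᵢⱼ}), P ∈ ℚ[t] — and which have the same value are
KZ-equivalent. The class contains every MZV simplex rep (KZ.mzvRep), Selberg- and cellular integrals
(BrownENS2009 §1, BrownCarrSchneps2010); its values are ℚ-combinations of MZVs of weight ≤ k
(BrownENS2009 Thm 1.1). Follows from DihedralNormalForm + MzvKernelInKZ (support item SectorGlue).
The card's envelope (all linearly reducible integrands, Brown2009/Panzer2015) is probed by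
WheelThreeSpokes and ArrangementNormalForm. [deps: DihedralNormalForm, MzvKernelInKZ, SectorGlue]
[difficulty: open-problem] -/
@[route_item "route-KontsevichZagierPeriods-LinRedNormalForm"]
def GenusZeroSector : Prop :=
  ∀ (k k' : ℕ) (r : Literature.NumberTheory.Transcendental.KZ.IntegralRep k) (r' : Literature.NumberTheory.Transcendental.KZ.IntegralRep k') (p : MvPolynomial (Fin k) ℚ) (a : Fin k → Fin k → ℕ) (b c : Fin k → ℕ) (p' : MvPolynomial (Fin k') ℚ) (a' : Fin k' → Fin k' → ℕ) (b' c' : Fin k' → ℕ), r.domain = {t | (∀ i, 0 < t i) ∧ (∀ i, t i < 1) ∧ StrictAnti t} → Set.EqOn r.integrand (fun t => MvPolynomial.aeval t p / ((∏ i, t i ^ b i) * (∏ i, (1 - t i) ^ c i) * ∏ i, ∏ j, if i < j then (t i - t j) ^ a i j else 1)) r.domain → r'.domain = {t | (∀ i, 0 < t i) ∧ (∀ i, t i < 1) ∧ StrictAnti t} → Set.EqOn r'.integrand (fun t => MvPolynomial.aeval t p' / ((∏ i, t i ^ b' i) * (∏ i, (1 - t i) ^ c' i) * ∏ i, ∏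 j, if i < j then (t i - t j) ^ a' i j else 1)) r'.domain → r.value = r'.value → Literature.NumberTheory.Transcendental.KZ.Equivalent r r'

/-- item stmt-KontsevichZagierPeriods-3912 · crux · rank 2 · open · by planner
why it might fail: Brown's proof restricts to boundary strata of M̄_{0,n} via regularised (tangential-basepoint) limits; where several letters collide with endpoints at a corner, paired counterterms may not keep EVERY intermediate absolutely convergent (route Neg, pressure point (a) regularisation).
sources: BrownENS2009, BognerBrown2015, Panzer2015, BrownCarrSchneps2010, KontsevichZagier2001, DupontPanzerPym2026
[crux] NORMAL FORM (the card's LinRedKZ on its typed core). Every absolutely convergent genus-zero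
rep [Δ_k, P/(∏tᵢ^{bᵢ}∏(1−tᵢ)^{cᵢ}∏_{i<j}(tᵢ−tⱼ)^{aᵢⱼ})] is KZ-equivalent to a ℤ-combination of MZV
WORD reps [Δ_w, q·∏ᵢ ω_{εᵢ}(tᵢ)] (ω₀ = 1/t, ω₁ = 1/(1−t), definitionally KZ.mzvForm; q ∈ ℚ absorbs
denominators since division by integers is not a rule; w = 0 gives the rational constants;
non-admissible words have no convergent rep and contribute nothing). Value-level shadow =
BrownENS2009 Thm 1.1 (periods of M_{0,n} lie in the MZV algebra), proved by integrating along the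
fibres of the forgetful maps M_{0,n+1} → M_{0,n} with hyperlogarithm primitives and REGULARISED
restriction to boundary divisors. Calculus version demanded here: keep every hyperlogarithm UNFOLDED
(a depth-d word = d extra simplex variables below the fibre variable y), so the primitive step
∫_{t₁}^1 ∂_y c(x,y)·ρ dy is ONE Newton–Leibniz move (rule 3) with algebraic primitive c(x,y)·ρ(x,t),
ρ = ∏(tᵢ−aᵢ(x))⁻¹, on the band t₁ ≤ y ≤ 1 over the base (x,t); partial fractions in y = integrand
additivity (1b); shuffles of simplex variables = domain additivity (1a) + coordinate permutations
(2); cubical↔simplicial coordinates -/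
@[route_item "route-KontsevichZagierPeriods-LinRedNormalForm"]
def DihedralNormalForm : Prop :=
  ∀ (k : ℕ) (r : Literature.NumberTheory.Transcendental.KZ.IntegralRep k) (p : MvPolynomial (Fin k) ℚ) (a : Fin k → Fin k → ℕ) (b c : Fin k → ℕ), r.domain = {t | (∀ i, 0 < t i) ∧ (∀ i, t i < 1) ∧ StrictAnti t} → Set.EqOn r.integrand (fun t => MvPolynomial.aeval t p / ((∏ i, t i ^ b i) * (∏ i, (1 - t i) ^ c i) * ∏ i, ∏ j, if i < j then (t i - t j) ^ a i j else 1)) r.domain → ∃ m ∈ AddSubgroup.closure {x : Literature.NumberTheory.Transcendental.KZ.FormalRep | ∃ (w : ℕ) (ε : Fin w → Bool) (q : ℚ) (s : Literature.NumberTheory.Transcendental.KZ.IntegralRep w), s.domain = {t | (∀ i, 0 < t i) ∧ (∀ i, t i < 1) ∧ StrictAnti t} ∧ Set.EqOn s.integrand (fun t => (q : ℝ) * ∏ i, if ε i then 1 / (1 - t i) else 1 / t i) s.domain ∧ x = Literature.NumberTheory.Transcendental.KZ.of s}, Literature.NumberTheory.Transcendental.KZ.of r - m ∈ Literature.NumberT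heory.Transcendental.KZ.relations

/-- item stmt-KontsevichZagierPeriods-3913 · crux · rank 3 · closed · proved by Summit.KontsevichZagierPeriods.LinRedNormalForm.WheelThreeSpokes.WheelThreeSpokes_of_siegelTamagawa @ 02da517a89a8 (prover) · by planner
why it might fail: Every published evaluation of P(K₄)=6ζ(3) leaves the calculus (Gegenbauer x-space, HyperInt reglim at 0/∞, graphical functions, BEK's motivic argument); all linearly reducible orders may force divergent words with no rational pairing — then an additive invariant might even separate the pair.
sources: BroadhurstKreimer1995, Schnetz2010, BlochEsnaultKreimer2006, Brown2009FeynmanPeriods, Panzer2015, lit:book:marcolli2009-feynman-motives p129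
[crux] THE FIRST FEYNMAN PERIOD INSIDE CONJECTURE 1. The wheel with three spokes K₄ (6 edges
e₁₂,e₁₃,e₁₄,e₂₃,e₂₄,e₃₄ ↔ x0,…,x4 and α₃₄ = 1 in the affine chart; Ψ = Kirchhoff polynomial = sum
over the 16 spanning-tree complements = all 3-subsets of edges except the 4 vertex stars): the
rational rep [ℝ₊⁵, 1/Ψ(x0,…,x4,1)²] (absolutely convergent: K₄ is primitive log-divergent; value
P(K₄) = 6ζ(3), BroadhurstKreimer1995, Schnetz2010 census P₃, lit:book:marcolli2009-feynman-motives
p129 'wheels give ζ(2n−3)'; the wheel motive BlochEsnaultKreimer2006) is KZ-equivalent to the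
rational simplex rep [1>t₀>t₁>t₂>0, 6/(t₀t₁(1−t₂))] (= 6·KZ.mzvRep [3] up to the rational factor).
K₄ is linearly reducible (vertex width 3: Brown2009FeynmanPeriods; HyperInt evaluates it:
Panzer2015) but NOT of dihedral shape — it probes the envelope beyond the typed core. A move chain
must (i) compactify ℝ₊⁵ by x ↦ x/(1−x) (rule 2, injective semialgebraic), (ii) run the unfolded
reduction in a linearly reducible order of the Schwinger variables, (iii) replace every regularised
limit at 0/∞ by a paired convergent rational rep, possibly after sector decomposition (blow-ups xᵢ =
yᵢyⱼ on cells = rule 2 + rule 1a). Nume -/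
@[route_item "route-KontsevichZagierPeriods-LinRedNormalForm"]
def WheelThreeSpokes : Prop :=
  ∀ (r : Literature.NumberTheory.Transcendental.KZ.IntegralRep 5) (r' : Literature.NumberTheory.Transcendental.KZ.IntegralRep 3), r.domain = {x | ∀ i, 0 < x i} → Set.EqOn r.integrand (fun x => 1 / (x 0 * x 1 * x 3 + x 0 * x 1 * x 4 + x 0 * x 1 + x 0 * x 2 * x 3 + x 0 * x 2 * x 4 + x 0 * x 2 + x 0 * x 3 + x 0 * x 4 + x 1 * x 2 * x 3 + x 1 * x 2 * x 4 + x 1 * x 2 + x 1 * x 3 * x 4 + x 1 * x 4 + x 2 * x 3 * x 4 + x 2 * x 3 + x 3 * x 4) ^ 2) r.domain → r'.domain = {t | 1 > t 0 ∧ t 0 > t 1 ∧ t 1 > t 2 ∧ t 2 > 0} → Set.EqOn r'.integrand (fun t => 6 / (t 0 * t 1 * (1 - t 2))) r'.domain → Literature.NumberTheory.Transcendental.KZ.Equivalent r r'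

-- `WheelThreeSpokes` holds: proved by `Summit.KontsevichZagierPeriods.LinRedNormalForm.WheelThreeSpokes.WheelThreeSpokes_of_siegelTamagawa` @ 02da517a89a8 (its module imports this route file, so no `_holds` link can be stated here).

/-- item stmt-KontsevichZagierPeriods-3914 · crux · rank 4 · open · by planner
why it might fail: Transcendence-complete as stated (needs Zagier's conjecture; Negative/Transfer.lean zeta_three_not_mem_span_of_crux), hence SCOPED 2026-08-16: derived in `closes` from HoffmanSpanInKZ ∧ HoffmanIndependence, not a closes hypothesis; associator/quasi-shuffle relations may lack convergent move chains.
sources: Zagier1994, Brown2012, IharaKanekoZagier2006, BrownCarrSchneps2010, Souderes2010, GoncharovECM2001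
[crux] KERNEL ON THE NORMAL FORMS. Every ℤ-combination of MZV word reps [Δ_w, q∏ω_{εᵢ}(tᵢ)] with
value 0 lies in KZ.relations. Intended proof shape (a tenure split once DihedralNormalForm moves):
(a) transcendence input Literature.NumberTheory.Transcendental.ZagierConjecture (dimension d_k and
weight grading; with Brown2012 = fact hoffmanSpan_eq_mzvSpace) ⇒ every ℚ-linear relation among real
MZVs is motivic; (b) motivic relations = formal-period relations of the Goncharov–Manin pairs
(M̄_{0,n}∖A, B∖(A∩B)) (GoncharovECM2001, BrownENS2009 §4) ⇒ generated by geometric operations —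
product/forgetful maps (the cell-zeta relations of BrownCarrSchneps2010, all between CONVERGENT
integrals), dihedral symmetry, Stokes/boundary — each to be shown a chain of moves with convergent
intermediates; the regularised double shuffle of IharaKanekoZagier2006 enters only through
convergent geometric avatars (Souderes2010: stuffle = integrand additivity 1/((1−a)(1−b)) =
1/((1−ab)(1−a)) + b/((1−ab)(1−b)) in cubical coordinates). Smallest instance = route Grothendieck
item GpcZeta4Eq4zeta31 (stmt-KontsevichZagierPeriods-0275, ζ(4) = 4ζ(3,1)); duality ζ(3) = ζ(2,1) is
ONE linear change of variables tᵢ ↦ 1 -/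
@[route_item "route-KontsevichZagierPeriods-LinRedNormalForm"]
def MzvKernelInKZ : Prop :=
  ∀ c ∈ AddSubgroup.closure {x : Literature.NumberTheory.Transcendental.KZ.FormalRep | ∃ (w : ℕ) (ε : Fin w → Bool) (q : ℚ) (s : Literature.NumberTheory.Transcendental.KZ.IntegralRep w), s.domain = {t | (∀ i, 0 < t i) ∧ (∀ i, t i < 1) ∧ StrictAnti t} ∧ Set.EqOn s.integrand (fun t => (q : ℝ) * ∏ i, if ε i then 1 / (1 - t i) else 1 / t i) s.domain ∧ x = Literature.NumberTheory.Transcendental.KZ.of s}, Literature.NumberTheory.Transcendental.KZ.eval c = 0 → c ∈ Literature.NumberTheory.Transcendental.KZ.relations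

/-- item stmt-KontsevichZagierPeriods-3915 · crux · rank 5 · open · by planner
why it might fail: Same convergence obstruction as DihedralNormalForm plus letter placement: after compactifying unbounded cells and rescaling fibres to (0,1), produced rational letters may fall inside (0,1) or pile up at both endpoints, forcing divergent intermediate words with no rational pairing.
sources: Brown2009, Panzer2015, PanzerThesis2015, BognerBrown2015
[crux] THE ENVELOPE, TYPED: RATIONAL HYPERPLANE ARRANGEMENTS. Every absolutely convergent rep whose
domain is an open rational polyhedral cell {x | ∀ j, 0 < Mⱼ·x + mⱼ} (M, m over ℚ; unbounded allowed)
and whose integrand is P(x)/∏ⱼ Lⱼ(x)^{eⱼ} with rational affine-linear forms Lⱼ is KZ-equivalent to a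
ℤ-combination of HYPERLOGARITHM WORD reps [Δ_w, q·∏ᵢ (tᵢ − aᵢ)⁻¹] with RATIONAL letters aᵢ
(necessarily ∉ (0,1) for convergence; the MZV words are the letters 0 and 1 up to sign).
Arrangements are linearly reducible in EVERY order (the resultant of two polynomials linear in x₁
whose x₁-coefficients are constants is again an affine-linear form), so the Brown–Panzer algorithm
(Brown2009 linear reducibility theorem; Panzer2015 HyperInt) evaluates them to ℚ-polynomials in
hyperlogarithms at rational points, = ℚ-combinations of convergent hyperlogarithm words after
shuffle regularisation; the braid arrangement {tᵢ, 1−tᵢ, tᵢ−tⱼ} on the simplex cell is the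
genus-zero core (DihedralNormalForm asks more there: letters in {0,1}). This is the card's
ConvergentReduction crux in the simplest infinite linearly reducible family beyond M_{0,n}: the
unfolded reduction must run with paired convergent co -/
@[route_item "route-KontsevichZagierPeriods-LinRedNormalForm"]
def ArrangementNormalForm : Prop :=
  ∀ (n m m' : ℕ) (r : Literature.NumberTheory.Transcendental.KZ.IntegralRep n) (M : Fin m' → (Fin n → ℚ) × ℚ) (L : Fin m → (Fin n → ℚ) × ℚ) (e : Fin m → ℕ) (p : MvPolynomial (Fin n) ℚ), r.domain = {x | ∀ j, 0 < ∑ i, ((M j).1 i : ℝ) * x i + ((M j).2 : ℝ)} → Set.EqOn r.integrand (fun x => MvPolynomial.aeval x p / ∏ j, (∑ i, ((L j).1 i : ℝ) * x i + ((L j).2 : ℝ)) ^ e j) r.domain → ∃ c ∈ AddSubgroup.closure {y : Literature.NumberTheory.Transcendental.KZ.FormalRep | ∃ (w : ℕ) (a : Fin w → ℚ) (q : ℚ) (s : Literature.NumberTheory.Transcendental.KZ.IntegralRep w), s.domain = {t | (∀ i, 0 < t i) ∧ (∀ i, t i < 1) ∧ StrictAnti t} ∧ Set.EqOn s.integrand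 (fun t => (q : ℝ) * ∏ i, 1 / (t i - (a i : ℝ))) s.domain ∧ y = Literature.NumberTheory.Transcendental.KZ.of s}, Literature.NumberTheory.Transcendental.KZ.of r - c ∈ Literature.NumberTheory.Transcendental.KZ.relations

/-- item stmt-KontsevichZagierPeriods-15044 · crux · rank 6 · open · by planner
why it might fail: Rules may be weaker than motives (HuberMullerStachPeriods2017 Rem 13.1.8): regularised double-shuffle/associator relations may admit no move chain with absolutely convergent intermediates, and EDS-completeness (IKZ2006 Conj. 1) is open beyond computer-checked weights.
sources: Brown2012, arXiv:1102.1312, arXiv:1102.1310, Hoffman1997, IharaKanekoZagier2006, Souderes2010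
[crux] SCOPING OF MzvKernelInKZ — THE MOTIVIC SIDE (route-repair 2026-08-16; judge: 'A if
MzvKernelInKZ is scoped to motivic relations'). Every MZV word generator [Δ_w, q·∏ω_ε] (binders
verbatim those of MzvKernelInKZ) is congruent modulo KZ.relations to a ℤ-combination of HOFFMAN
generators [Δ_w, q'·ω_u] — u ∈ {2,3}^×, |u| = w, q' ∈ ℚ, integrand q'·KZ.mzvIntegrand u on the open
ordered simplex (w = 0: the constants [pt, q]; u = ∅). These are MOTIVIC relations: by Brown2012 Thm
1.1/7.4 the motivic Hoffman elements are a basis of motivic MZVs, so ζᵐ(ε) = Σ_u c_u ζᵐ(u) holds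
motivically (coefficients computable by the decomposition algorithm arXiv:1102.1310); the item asks
that these relations — and nothing transcendental — be move chains (any real-valid rational
coefficients are accepted; under HoffmanIndependence they are Brown's). It is implied by 'every
motivic relation among MZVs lies in KZ.relations' and, with HoffmanIndependence, it implies
MzvKernelInKZ (transfer proved inside `closes`; Theorems-level twin:
Theorems/MzvKernelInKZ/Negative/Transfer.lean `cruxAdm_of_family`, `crux_iff_cruxAdm`). WHY THIS
FORM IS EASIER than MzvKernelInKZ: a SPANNING statement (exhibit move chai -/
@[route_item "route-KontsevichZagierPeriods-LinRedNormalForm"]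
def HoffmanSpanInKZ : Prop :=
  ∀ (w : ℕ) (ε : Fin w → Bool) (q : ℚ) (s : Literature.NumberTheory.Transcendental.KZ.IntegralRep w), s.domain = {t | (∀ i, 0 < t i) ∧ (∀ i, t i < 1) ∧ StrictAnti t} → Set.EqOn s.integrand (fun t => (q : ℝ) * ∏ i, if ε i then 1 / (1 - t i) else 1 / t i) s.domain → ∃ m ∈ AddSubgroup.closure {x : Literature.NumberTheory.Transcendental.KZ.FormalRep | ∃ (u : List ℕ) (q' : ℚ) (s' : Literature.NumberTheory.Transcendental.KZ.IntegralRep (Literature.NumberTheory.Transcendental.MZV.weight u)), Literature.NumberTheory.Transcendental.MZV.IsHoffman u ∧ Literature.NumberTheory.Transcendental.MZV.weight u = w ∧ s'.domain = {t | (∀ i, 0 < t i) ∧ (∀ i, t i < 1) ∧ StrictAnti t} ∧ Set.EqOn s'.integrand (fun t => (q' : ℝ) * Literature.NumberTheory.Transcendental.KZ.mzvIntegrand u t) s'.domain ∧ x = Literature.NumberTheory.Transcendental.KZ.of s'}, Literature.NumberTheory.Transcendental.KZ.of s - m ∈ Literature.NumberTheory.Transcendental.KZ.relations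

/-- item stmt-KontsevichZagierPeriods-15045 · crux · rank 7 · open · by planner
why it might fail: Zagier-conjecture strength, open: fails iff ONE ℚ-linear relation among real Hoffman MZVs exists (none known or expected); no transcendence method reaches even ζ(5) ∉ ℚ·ζ(2)ζ(3) or ζ(3)/π³ ∉ ℚ, so it can be neither proved nor cheaply killed here.
sources: Zagier1994, Brown2012, GoncharovECM2001, Hoffman1997, IharaKanekoZagier2006, KontsevichZagier2001
[crux] DECLARED TRANSCENDENCE INPUT — NAMED, NOT ATTACKED FROM THIS ROUTE (route-repair 2026-08-16:
the hypothesis that scopes MzvKernelInKZ to motivic relations; D-0027 §2.2: a hypothesis of `closes`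
is a crux). The real Hoffman values ζ(u), u ∈ {2,3}^× (all weights together, ζ(∅) = 1 included), are
ℚ-linearly independent. Given Brown's theorem (Literature fact hoffmanSpan_eq_mzvSpace, Brown2012
Thm 1.1) and zagierDim_eq_card_hoffman this is EQUIVALENT to
Literature.NumberTheory.Transcendental.ZagierConjecture (dimension conjecture ∧ weight grading;
Zagier1994 §9, GoncharovECM2001 Conj. 1.1), i.e. to injectivity of the period map H → ℝ on Brown's
motivic MZVs (Grothendieck's period conjecture for MT(ℤ) restricted to MZVs). Verbatim the
hypothesis `HoffmanIndependent` of the two-posets line (Theorems/MzvKernelInKZTwoPosetsDefs.lean;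
bridge `ZagierConjecture → hoffmanSpan_eq_mzvSpace → HoffmanIndependent`,
Theorems/MzvKernelInKZTwoPosetsHoffmanIndependence.lean) and of route CoactionDevissage item
SectorAssembly. It is the ONLY transcendence content of the route's MZV sector: HoffmanSpanInKZ ∧
HoffmanIndependence ⇒ MzvKernelInKZ (proved inside `closes`); conversely MzvKernelInKZ for -/
@[route_item "route-KontsevichZagierPeriods-LinRedNormalForm"]
def HoffmanIndependence : Prop :=
  LinearIndependent ℚ (fun u : {u : List ℕ // Literature.NumberTheory.Transcendental.MZV.IsHoffman u} => Literature.NumberTheory.Transcendental.multipleZeta u.1)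

/-- item stmt-KontsevichZagierPeriods-3917 · crux · rank 9 · open · by planner
why it might fail: Summit strength off the sector (S ⇐ KZKernelConjecture, p77321; nothing weaker is known): false as soon as ONE vanishing combination with a non-mixed-Tate member — an elliptic or Γ-value period — has no move chain into genus zero, even with DihedralNormalForm ∧ MzvKernelInKZ true.
sources: KontsevichZagier2001, HuberMullerStachPeriods2017, Ayoub2015, CressonViusos2022, HuberWustholz2022
[support] DECLARED RESIDUAL — DO NOT ATTEMPT DIRECTLY. Every vanishing formal combination is
congruent modulo KZ.relations to a ℤ-combination of genus-zero reps. Given the sector cruxes it is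
EQUIVALENT to the summit (it is implied by KontsevichZagierPeriods via exists_integralRep_sub-type
bookkeeping, and with DihedralNormalForm + MzvKernelInKZ it implies KZKernelConjecture); it is filed
only so that the Assembly is an honest implication ending in the summit and so that the sector
boundary of this route is explicit. The complement (elliptic and higher-genus letters, Γ-detours,
general Nori motives) is owned by routes NoriTransfer, Grothendieck, AyoubSpecialisation,
ExpConservative and by the card genus-one-double-shuffle-elliptic-associator; the strength barriers
kzConjecture_implies_{oddZetaAlgIndep, twoPiI_log_algIndep, ellipticPeriods_algIndep} all sit here.
[deps: none] [difficulty: open-problem] -/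
@[route_item "route-KontsevichZagierPeriods-LinRedNormalForm"]
def ResidualBeyondGenusZero : Prop :=
  ∀ c : Literature.NumberTheory.Transcendental.KZ.FormalRep, Literature.NumberTheory.Transcendental.KZ.eval c = 0 → ∃ c₀ ∈ AddSubgroup.closure {x : Literature.NumberTheory.Transcendental.KZ.FormalRep | ∃ (k : ℕ) (r : Literature.NumberTheory.Transcendental.KZ.IntegralRep k) (p : MvPolynomial (Fin k) ℚ) (a : Fin k → Fin k → ℕ) (b c : Fin k → ℕ), r.domain = {t | (∀ i, 0 < t i) ∧ (∀ i, t i < 1) ∧ StrictAnti t} ∧ Set.EqOn r.integrand (fun t => MvPolynomial.aeval t p / ((∏ i, t i ^ b i) * (∏ i, (1 - t i) ^ c i) * ∏ i, ∏ j, if i < j then (t i - t j) ^ a i j else 1)) r.domain ∧ x = Literature.NumberTheory.Transcendental.KZ.of r}, c - c₀ ∈ Literature.NumberTheory.Transcendental.KZ.relations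

/-- item stmt-KontsevichZagierPeriods-14821 · support · rank 9 · open · by planner
[support] KERNEL ON HYPERLOGARITHM WORD REPRESENTATIONS — the arrangement-sector analogue of
MzvKernelInKZ; a DECLARED SECTOR KERNEL, summit-strength on its sector (it is the kernel form of
Conjecture 1, Literature.NumberTheory.Transcendental.KZKernelConjecture, restricted to this
subgroup, hence implied by the summit and not refutable short of refuting it); filed as support, NOT
a staffing crux. Statement: every ℤ-combination of hyperlogarithm word representations [Δ_w, q·∏ᵢ
(tᵢ − aᵢ)⁻¹] (open ordered simplex, rational letters aᵢ, q ∈ ℚ — verbatim the generator set of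
ArrangementNormalForm's conclusion) whose value is 0 lies in KZ.relations. MzvKernelInKZ is the
sub-case letters ⊆ {0,1}: an MZV word rep IS a hyperlogarithm word rep with aᵢ = [εᵢ], q' =
(−1)^{#ε}·q (1/(1−t) = −1/(t−1); closure_mono step proved in the planner's Sketch.lean), so
HyperlogKernelInKZ → MzvKernelInKZ is a two-line corollary. Values here are ℚ-combinations of
multiple polylogarithms at rational arguments (Goncharov's hyperlogarithms with rational letters;
periods of mixed Tate motives over ℤ[1/N]); expected proof shape = that of MzvKernelInKZ one level
up: (a) transcendence input, the period conjecture fo -/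
@[route_item "route-KontsevichZagierPeriods-LinRedNormalForm"]
def HyperlogKernelInKZ : Prop :=
  ∀ c ∈ AddSubgroup.closure {y : Literature.NumberTheory.Transcendental.KZ.FormalRep | ∃ (w : ℕ) (a : Fin w → ℚ) (q : ℚ) (s : Literature.NumberTheory.Transcendental.KZ.IntegralRep w), s.domain = {t | (∀ i, 0 < t i) ∧ (∀ i, t i < 1) ∧ StrictAnti t} ∧ Set.EqOn s.integrand (fun t => (q : ℝ) * ∏ i, 1 / (t i - (a i : ℝ))) s.domain ∧ y = Literature.NumberTheory.Transcendental.KZ.of s}, Literature.NumberTheory.Transcendental.KZ.eval c = 0 → c ∈ Literature.NumberTheory.Transcendental.KZ.relations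

/-- item stmt-KontsevichZagierPeriods-14838 · support · rank 9 · open · by planner
[support] BROWN'S THEOREM, TYPED — the value-level shadow of DihedralNormalForm; a KNOWN RESULT
(cite-level), no move content. For every absolutely convergent genus-zero representation r = [Δ_k,
P/(∏tᵢ^{bᵢ}∏(1−tᵢ)^{cᵢ}∏_{i<j}(tᵢ−tⱼ)^{aᵢⱼ})] (binders verbatim those of DihedralNormalForm) there
is a ℤ-combination m of MZV word representations [Δ_w, q·∏ω_{εᵢ}(tᵢ)] (q ∈ ℚ inside the generator; w
= 0 gives the rational constants) with KZ.eval m = r.value. This is BrownENS2009 Thm 1.1 in the form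
proved there: a regular ℓ-form on M_{0,ℓ+3} (poles only on the braid arrangement tᵢ = 0, tᵢ = 1, tᵢ
= tⱼ) which converges absolutely on the standard cell is a ℚ-linear combination of the dihedral
integrals I_{S,δ}(α), α ≥ 0 (arXiv:math/0606419 Lemma 7.4: absolute convergence ⇔ no poles along
∂X̄_{S,δ}, forcing a polynomial in the u_{ij}), each of which lies in the ℚ-span of MZVs of weight ≤
ℓ (Thm 8.2, Cor 8.3), the MZVs arising at the last induction step as iterated integrals over
simplices, i.e. as values of MZV word reps (a convergent word rep exists for every admissible word:
disprover by-product WordReps.lean `exists_wordRep` on item stmt-KontsevichZagierPeriods-3915; cf.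
Theorems/LinRedNor -/
@[route_item "route-KontsevichZagierPeriods-LinRedNormalForm"]
def GenusZeroValuesMzv : Prop :=
  ∀ (k : ℕ) (r : Literature.NumberTheory.Transcendental.KZ.IntegralRep k) (p : MvPolynomial (Fin k) ℚ) (a : Fin k → Fin k → ℕ) (b c : Fin k → ℕ), r.domain = {t | (∀ i, 0 < t i) ∧ (∀ i, t i < 1) ∧ StrictAnti t} → Set.EqOn r.integrand (fun t => MvPolynomial.aeval t p / ((∏ i, t i ^ b i) * (∏ i, (1 - t i) ^ c i) * ∏ i, ∏ j, if i < j then (t i - t j) ^ a i j else 1)) r.domain → ∃ m ∈ AddSubgroup.closure {x : Literature.NumberTheory.Transcendental.KZ.FormalRep | ∃ (w : ℕ) (ε : Fin w → Bool) (q : ℚ) (s : Literature.NumberTheory.Transcendental.KZ.IntegralRep w), s.domain = {t | (∀ i, 0 < t i) ∧ (∀ i, t i < 1) ∧ StrictAnti t} ∧ Set.EqOn s.integrand (fun t => (q : ℝ) * ∏ i, if ε i then 1 / (1 - t i) else 1 / t i) s.domain ∧ x = Literature.NumberTheory.Transcendental.KZ.of s}, Literature.NumberTheory.Transcendental.KZ.eval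 m = r.value

/-- item stmt-KontsevichZagierPeriods-14839 · support · rank 9 · closed · proved by Summit.KontsevichZagierPeriods.LinRedNormalForm.arrangementSectorGlue_proof (prover) · by planner
[support] GLUE (route-repair 2026-08-16, unused-crux): ArrangementNormalForm → HyperlogKernelInKZ →
GenusZeroValuesMzv → DihedralNormalForm — connects crux #5 ArrangementNormalForm to the `closes`
hypothesis DihedralNormalForm. Meaning: the dihedral normal form splits into an ANALYTIC half — a
convergent-intermediate reduction to hyperlogarithm words with FREE rational letters, which is
exactly ArrangementNormalForm applied to the braid arrangement (the open ordered simplex is the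
rational polyhedral cell {tᵢ > 0, 1 − tᵢ > 0, tᵢ − tⱼ > 0 (i<j)} and the genus-zero integrand is
P/∏ⱼLⱼ^{eⱼ} for the affine forms tᵢ, 1 − tᵢ, tᵢ − tⱼ) — and an ARITHMETIC half — purging letters
outside {0,1}, i.e. the hyperlogarithm kernel, the value being MZV by Brown. PROVED SORRY-FREE in
the planner's Sketch.lean (attached as evidence on this item: candidate proof
`arrangementSectorGlue_skeleton`, ≈130 lines incl. the matching lemmas, lean check rc0, axioms
propext/Classical.choice/Quot.sound) — a prover only has to land it under Theorems/. Proof: given a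
genus-zero r, (i) MATCHING: rows indexed by (Fin k ⊕ Fin k) ⊕ (Fin k × Fin k) transported along
finSumFinEquiv/finProdFinEquiv to Fin (k + k + k·k): -/
@[route_item "route-KontsevichZagierPeriods-LinRedNormalForm"]
def ArrangementSectorGlue : Prop :=
  ArrangementNormalForm → HyperlogKernelInKZ → GenusZeroValuesMzv → DihedralNormalForm

-- `ArrangementSectorGlue` holds: proved by `Summit.KontsevichZagierPeriods.LinRedNormalForm.arrangementSectorGlue_proof` (its module imports this route file, so no `_holds` link can be stated here).

/-- item stmt-KontsevichZagierPeriods-3916 · support · rank 9 · closed · proved by Summit.KontsevichZagierPeriods.LinRedNormalForm.sectorGlue_proof @ aef67d3552ad (prover) · by planner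
[support] GLUE, provable now (~40 lines): r, r′ genus-zero with equal values; DihedralNormalForm
gives m, m′ ∈ AddSubgroup.closure(MZV word reps) with [r] − m, [r′] − m′ ∈ relations; soundness
Literature.NumberTheory.Transcendental.KZ.relations_le_ker_eval_holds gives eval(m − m′) = r.value −
r′.value = 0; MzvKernelInKZ gives m − m′ ∈ relations; add. [deps: DihedralNormalForm, MzvKernelInKZ,
GenusZeroSector] [difficulty: provable-now] -/
@[route_item "route-KontsevichZagierPeriods-LinRedNormalForm"]
def SectorGlue : Prop :=
  DihedralNormalForm → MzvKernelInKZ → GenusZeroSector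

-- `SectorGlue` holds: proved by `Summit.KontsevichZagierPeriods.LinRedNormalForm.sectorGlue_proof` @ aef67d3552ad (its module imports this route file, so no `_holds` link can be stated here).

/-- item stmt-KontsevichZagierPeriods-3918 · support · rank 9 · closed · proved by Summit.KontsevichZagierPeriods.LinRedNormalForm.BeukersZeta3.beukersZeta3_proof (prover) · by planner
[support] CALIBRATION of the unfolded engine at depth one, provable now with effort (~6 moves + side
conditions): Beukers' n = 0 integral [(0,1)³, 1/(1−(1−xy)z)] (value 2ζ(3); planner MC 2.4013 ± 0.004
vs 2.40411) ~ [1>t₀>t₁>t₂>0, 2/(t₀t₁(1−t₂))]. Chain: CoV (x,y,z) ↦ (x,y,u = 1−(1−xy)z) (rule 2;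
injective on the cube, Jacobian (1−xy)) gives [{0<x,y<1, xy<u<1}, 1/(u(1−xy))] — the UNFOLDED form
of −log(xy)/(1−xy), letter 0 colliding with the endpoint but convergent as one rep; domain
additivity {xy<u<1} = {x<u<1} ∪ {xy<u<x} (rule 1a, null overlap); CoV u = xv on the second piece
(rule 2) and the swap x ↔ y identify the two pieces with [{0<x,y<1, x<u<1}, 1/(u(1−xy))]; finally
the cubical-to-simplicial CoV (t₀,t₁,t₂) = (u, x, xy)-type maps (rule 2) land on the ζ(3) word rep,
coefficient 2 realised by domain additivity of two disjoint copies / integrand additivity. Provers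
discharge IsSemialgebraicMapOn / HasFDerivWithinAt / InjOn / IntegrableOn side conditions as in
route LowDimension item LowdimDuplicationOneThird. [deps: none] [difficulty: M] -/
@[route_item "route-KontsevichZagierPeriods-LinRedNormalForm"]
def BeukersZeta3 : Prop :=
  ∀ (r r' : Literature.NumberTheory.Transcendental.KZ.IntegralRep 3), r.domain = {x | ∀ i, x i ∈ Set.Ioo (0:ℝ) 1} → Set.EqOn r.integrand (fun x => 1 / (1 - (1 - x 0 * x 1) * x 2)) r.domain → r'.domain = {t | 1 > t 0 ∧ t 0 > t 1 ∧ t 1 > t 2 ∧ t 2 > 0} → Set.EqOn r'.integrand (fun t => 2 / (t 0 * t 1 * (1 - t 2))) r'.domain → Literature.NumberTheory.Transcendental.KZ.Equivalent r r'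

-- `BeukersZeta3` holds: proved by `Summit.KontsevichZagierPeriods.LinRedNormalForm.BeukersZeta3.beukersZeta3_proof` (its module imports this route file, so no `_holds` link can be stated here).

/-- item stmt-KontsevichZagierPeriods-3919 · assembly · rank 1 · closed · proved by Summit.KontsevichZagierPeriods.LinRedNormalForm.assembly_proof @ 3105e4d941a0 (prover) · by planner
[assembly] DihedralNormalForm → MzvKernelInKZ → ResidualBeyondGenusZero → KontsevichZagierPeriods.
Provable now (~60 lines): given r, r′ rational with equal values put c = [r] − [r′], eval c = 0
(map_sub, KZ.eval_of); Residual gives c₀ ∈ AddSubgroup.closure(genus-zero reps) with c − c₀ ∈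
relations, so eval c₀ = 0 by Literature.NumberTheory.Transcendental.KZ.relations_le_ker_eval_holds;
AddSubgroup.closure_induction with DihedralNormalForm on generators gives m ∈ closure(MZV word reps)
with c₀ − m ∈ relations, eval m = 0; MzvKernelInKZ gives m ∈ relations; hence c ∈ relations, i.e.
KZ.Equivalent r r′ (pattern of Theorems/KernelFormKernelImpliesStatement.lean). [deps:
DihedralNormalForm, MzvKernelInKZ, ResidualBeyondGenusZero] [difficulty: provable-now] -/
@[route_item "route-KontsevichZagierPeriods-LinRedNormalForm"]
def Assembly : Prop :=
  DihedralNormalForm → MzvKernelInKZ → ResidualBeyondGenusZero → KontsevichZagierPeriods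

-- `Assembly` holds: proved by `Summit.KontsevichZagierPeriods.LinRedNormalForm.assembly_proof` @ 3105e4d941a0 (its module imports this route file, so no `_holds` link can be stated here).

/-! D-0027 §2.1 — DECIDING THEOREM (planner-authored via `route open/edit --closes-file`; by planner-rrepair-KontsevichZagierPeriods-LinRed-9e234977-0 2026-08-16T07:36:40Z):
its hypotheses are this route's items and its conclusion the sub-problem Statement (glue_lint), and it elaborates with this file. -/

/-- D-0027 §2.1 deciding theorem of route LinRedNormalForm (route-repair 2026-08-16: `MzvKernelInKZ` SCOPED TO
MOTIVIC RELATIONS). Hypotheses = crux items only: `DihedralNormalForm` (#2, genus-zero normal form),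
`HoffmanSpanInKZ` (#6, the motivic side of the MZV kernel: Brown's Hoffman expansions realised by moves),
`HoffmanIndependence` (#7, the DECLARED transcendence input: ℚ-independence of the real Hoffman values =
Zagier's conjecture in Brown's basis) and `ResidualBeyondGenusZero` (#8, the DECLARED complement of the
sector). Proof: `MzvKernelInKZ` (#4) is first DERIVED from #6 ∧ #7 — a vanishing ℤ-combination of MZV word
representations is congruent (closure induction with #6) to an element `m` of the subgroup generated by the
Hoffman representations `[Δ, q·ω_u]`; modulo relations `m = ∑_u cls [Δ, l(u)·ω_u]` for a finitely supported
`l` (the coefficient map `q ↦ cls [Δ, q·ω_u]` is additive by integrand additivity); its value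
`∑_u l(u)·ζ(u)` (`KZ.mzvRep_value_holds`) vanishes by soundness, so `l = 0` by #7 and `m` is a relation.
Then, for rational `r, r'` with equal values, `c = [r] - [r']` has `eval c = 0`; #8 gives `c₀` in the
genus-zero closure with `c - c₀ ∈ relations`; #2 extended additively gives `m` in the MZV-word closure with
`c₀ - m ∈ relations`; soundness gives `eval m = 0`, the derived kernel `m ∈ relations`, and
`c = (c - c₀) + (c₀ - m) + m ∈ relations`. -/
@[closes "route-KontsevichZagierPeriods-LinRedNormalForm"] theorem closes : DihedralNormalForm → HoffmanSpanInKZ → HoffmanIndependence → ResidualBeyondGenusZero → KontsevichZagierPeriods := by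
  intro hNF hSPAN hIND hRES
  have hsound : ∀ x ∈ NumberTheory.Transcendental.KZ.relations,
      NumberTheory.Transcendental.KZ.eval x = 0 := fun x hx =>
    (AddMonoidHom.mem_ker).1 (NumberTheory.Transcendental.KZ.relations_le_ker_eval_holds hx)
  have hext : ∀ {S T : Set NumberTheory.Transcendental.KZ.FormalRep}
      (c : NumberTheory.Transcendental.KZ.FormalRep), c ∈ AddSubgroup.closure S →
      (∀ x ∈ S, ∃ m ∈ AddSubgroup.closure T,
        x - m ∈ NumberTheory.Transcendental.KZ.relations) →
      ∃ m ∈ AddSubgroup.closure T, c - m ∈ NumberTheory.Transcendental.KZ.relations := by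
    intro S T c hc hS
    induction hc using AddSubgroup.closure_induction with
    | mem x hx => exact hS x hx
    | zero => exact ⟨0, zero_mem _, by simp⟩
    | add x y _ _ ihx ihy =>
      obtain ⟨m₁, hm₁, h₁⟩ := ihx
      obtain ⟨m₂, hm₂, h₂⟩ := ihy
      refine ⟨m₁ + m₂, add_mem hm₁ hm₂, ?_⟩
      have key := add_mem h₁ h₂
      rwa [show x - m₁ + (y - m₂) = x + y - (m₁ + m₂) by abel] at key
    | neg x _ ih =>
      obtain ⟨m, hm, h⟩ := ih
      refine ⟨-m, neg_mem hm, ?_⟩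
      have key := neg_mem h
      rwa [show -(x - m) = -x - -m by abel] at key
  have hzero : ∀ {n : ℕ} (z : NumberTheory.Transcendental.KZ.IntegralRep n),
      (∀ x ∈ z.domain, z.integrand x = 0) →
        NumberTheory.Transcendental.KZ.of z ∈ NumberTheory.Transcendental.KZ.relations := by
    intro n z hz
    have h3 : NumberTheory.Transcendental.KZ.of z - NumberTheory.Transcendental.KZ.of z -
        NumberTheory.Transcendental.KZ.of z ∈ NumberTheory.Transcendental.KZ.relations :=
      NumberTheory.Transcendental.KZ.integrandAddRel_subset_relations
        ⟨n, z, z, z, rfl, rfl, fun x hx => by simp [hz x hx], rfl⟩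
    rw [show NumberTheory.Transcendental.KZ.of z - NumberTheory.Transcendental.KZ.of z -
        NumberTheory.Transcendental.KZ.of z = -NumberTheory.Transcendental.KZ.of z by abel] at h3
    exact neg_mem_iff.mp h3
  have hcongr : ∀ {n : ℕ} (r r' : NumberTheory.Transcendental.KZ.IntegralRep n),
      r'.domain = r.domain → Set.EqOn r.integrand r'.integrand r.domain →
        NumberTheory.Transcendental.KZ.of r - NumberTheory.Transcendental.KZ.of r' ∈
          NumberTheory.Transcendental.KZ.relations := by
    intro n r r' hd h
    let z : NumberTheory.Transcendental.KZ.IntegralRep n := r.constMul 0 isAlgebraic_zero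
    have hz : ∀ x ∈ z.domain, z.integrand x = 0 := fun x _ => by
      simp [z, NumberTheory.Transcendental.KZ.IntegralRep.integrand_constMul]
    have h1 : NumberTheory.Transcendental.KZ.of r - NumberTheory.Transcendental.KZ.of r' -
        NumberTheory.Transcendental.KZ.of z ∈ NumberTheory.Transcendental.KZ.relations :=
      NumberTheory.Transcendental.KZ.integrandAddRel_subset_relations
        ⟨n, r, r', z, hd, rfl, fun x hx => by
          simp [z, NumberTheory.Transcendental.KZ.IntegralRep.integrand_constMul, h hx], rfl⟩
    have h2 := hzero z hz
    rw [show NumberTheory.Transcendental.KZ.of r - NumberTheory.Transcendental.KZ.of r' =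
        (NumberTheory.Transcendental.KZ.of r - NumberTheory.Transcendental.KZ.of r' -
          NumberTheory.Transcendental.KZ.of z) + NumberTheory.Transcendental.KZ.of z by abel]
    exact add_mem h1 h2
  have hKER : MzvKernelInKZ := by
    let T : Set NumberTheory.Transcendental.KZ.FormalRep :=
      {x | ∃ (u : List ℕ) (q' : ℚ)
        (s' : NumberTheory.Transcendental.KZ.IntegralRep (NumberTheory.Transcendental.MZV.weight u)),
        NumberTheory.Transcendental.MZV.IsHoffman u ∧
        s'.domain = {t | (∀ i, 0 < t i) ∧ (∀ i, t i < 1) ∧ StrictAnti t} ∧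
        Set.EqOn s'.integrand (fun t => (q' : ℝ) * NumberTheory.Transcendental.KZ.mzvIntegrand u t) s'.domain ∧
        x = NumberTheory.Transcendental.KZ.of s'}
    let canon : (u : {u : List ℕ // NumberTheory.Transcendental.MZV.IsHoffman u}) → ℚ →
        NumberTheory.Transcendental.KZ.IntegralRep (NumberTheory.Transcendental.MZV.weight u.1) :=
      fun u q => (NumberTheory.Transcendental.KZ.mzvRep u.1 u.2.isAdmissible
        (NumberTheory.Transcendental.KZ.mzvIntegrand_isSemialgebraicFunOn_holds u.1)
        (NumberTheory.Transcendental.KZ.mzvIntegrand_integrableOn_holds u.1 u.2.isAdmissible)).constMul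
          (q : ℝ) (isAlgebraic_algebraMap q)
    have canon_integrand : ∀ u q t, (canon u q).integrand t =
        (q : ℝ) * NumberTheory.Transcendental.KZ.mzvIntegrand u.1 t := fun u q t => rfl
    have canon_domain : ∀ u q, (canon u q).domain = {t | (∀ i, 0 < t i) ∧ (∀ i, t i < 1) ∧ StrictAnti t} :=
      fun u q => rfl
    have canon_value : ∀ u q, (canon u q).value =
        (q : ℝ) * NumberTheory.Transcendental.multipleZeta u.1 := fun u q => by
      simp only [canon, NumberTheory.Transcendental.KZ.IntegralRep.value_constMul]
      rw [NumberTheory.Transcendental.KZ.mzvRep_value_holds]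
    let cls : NumberTheory.Transcendental.KZ.FormalRep →+
        NumberTheory.Transcendental.KZ.FormalRep ⧸ NumberTheory.Transcendental.KZ.relations :=
      QuotientAddGroup.mk' _
    have cls_zero_iff : ∀ c, cls c = 0 ↔ c ∈ NumberTheory.Transcendental.KZ.relations :=
      fun c => QuotientAddGroup.eq_zero_iff c
    have cls_eq_iff : ∀ c c', cls c = cls c' ↔ c - c' ∈ NumberTheory.Transcendental.KZ.relations := by
      intro c c'
      rw [← sub_eq_zero, ← map_sub, cls_zero_iff]
    let coef : (u : {u : List ℕ // NumberTheory.Transcendental.MZV.IsHoffman u}) →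
        ℚ →+ NumberTheory.Transcendental.KZ.FormalRep ⧸ NumberTheory.Transcendental.KZ.relations :=
      fun u =>
        { toFun := fun q => cls (NumberTheory.Transcendental.KZ.of (canon u q))
          map_zero' := by
            rw [cls_zero_iff]
            exact hzero _ fun t _ => by rw [canon_integrand]; simp
          map_add' := fun q₁ q₂ => by
            rw [← map_add, cls_eq_iff, ← sub_sub]
            exact NumberTheory.Transcendental.KZ.integrandAddRel_subset_relations
              ⟨_, canon u (q₁ + q₂), canon u q₁, canon u q₂, rfl, rfl, fun t _ => by
                simp only [canon_integrand, Pi.add_apply, Rat.cast_add]; ring, rfl⟩ }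
    have coef_apply : ∀ u q, coef u q = cls (NumberTheory.Transcendental.KZ.of (canon u q)) :=
      fun u q => rfl
    let nf : ({u : List ℕ // NumberTheory.Transcendental.MZV.IsHoffman u} →₀ ℚ) →+
        NumberTheory.Transcendental.KZ.FormalRep ⧸ NumberTheory.Transcendental.KZ.relations :=
      Finsupp.liftAddHom coef
    have nf_apply : ∀ l, nf l = l.sum fun u q => cls (NumberTheory.Transcendental.KZ.of (canon u q)) :=
      fun l => Finsupp.liftAddHom_apply _ _
    have nf_single : ∀ u q, nf (Finsupp.single u q) = cls (NumberTheory.Transcendental.KZ.of (canon u q)) :=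
      fun u q => (Finsupp.liftAddHom_apply_single coef u q).trans (coef_apply u q)
    let evalQ : NumberTheory.Transcendental.KZ.FormalRep ⧸ NumberTheory.Transcendental.KZ.relations →+ ℝ :=
      QuotientAddGroup.lift _ NumberTheory.Transcendental.KZ.eval
        NumberTheory.Transcendental.KZ.relations_le_ker_eval_holds
    have evalQ_cls : ∀ c, evalQ (cls c) = NumberTheory.Transcendental.KZ.eval c := fun c => rfl
    have evalQ_nf : ∀ l, evalQ (nf l) = l.sum fun u q => (q : ℝ) * NumberTheory.Transcendental.multipleZeta u.1 :=
      fun l => by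
        rw [nf_apply, map_finsuppSum]
        exact Finsupp.sum_congr fun u _ => by
          rw [evalQ_cls, NumberTheory.Transcendental.KZ.eval_of, canon_value]
    have key : ∀ m ∈ AddSubgroup.closure T, ∃ l, cls m = nf l := by
      intro m hm
      induction hm using AddSubgroup.closure_induction with
      | mem x hx =>
        obtain ⟨u, q', s', hu, hd, hi, rfl⟩ := hx
        refine ⟨Finsupp.single ⟨u, hu⟩ q', ?_⟩
        rw [nf_single, cls_eq_iff]
        exact hcongr s' (canon ⟨u, hu⟩ q') (by rw [hd]; rfl) fun t ht => by
          rw [canon_integrand]; exact hi ht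
      | zero => exact ⟨0, by simp⟩
      | add x y _ _ ihx ihy =>
        obtain ⟨l₁, h₁⟩ := ihx
        obtain ⟨l₂, h₂⟩ := ihy
        exact ⟨l₁ + l₂, by rw [map_add, map_add, h₁, h₂]⟩
      | neg x _ ih =>
        obtain ⟨l, h⟩ := ih
        exact ⟨-l, by rw [map_neg, map_neg, h]⟩
    intro c hc hc0
    obtain ⟨m, hm, hcm⟩ := hext (T := T) c hc (fun x hx => by
      obtain ⟨w, ε, q, s, hdom, hint, rfl⟩ := hx
      obtain ⟨m, hm, h⟩ := hSPAN w ε q s hdom hint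
      refine ⟨m, AddSubgroup.closure_mono ?_ hm, h⟩
      rintro x ⟨u, q', s', hu, -, hd, hi, rfl⟩
      exact ⟨u, q', s', hu, hd, hi, rfl⟩)
    have hm0 : NumberTheory.Transcendental.KZ.eval m = 0 := by
      have := hsound _ hcm
      rw [map_sub, hc0] at this
      linarith
    obtain ⟨l, hl⟩ := key m hm
    have hev : evalQ (nf l) = 0 := by rw [← hl, evalQ_cls, hm0]
    have hl0 : l = 0 := by
      refine linearIndependent_iff.mp hIND l ?_
      rw [Finsupp.linearCombination_apply]
      rw [evalQ_nf] at hev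
      simpa [Rat.smul_def] using hev
    rw [hl0, map_zero, cls_zero_iff] at hl
    have := add_mem hcm hl
    rwa [sub_add_cancel] at this
  intro n n' r r' _ _ hv
  suffices hker : ∀ c : NumberTheory.Transcendental.KZ.FormalRep,
      NumberTheory.Transcendental.KZ.eval c = 0 →
        c ∈ NumberTheory.Transcendental.KZ.relations by
    apply hker
    simp [NumberTheory.Transcendental.KZ.eval_of, hv]
  intro c hc
  obtain ⟨c₀, hc₀, hcc₀⟩ := hRES c hc
  obtain ⟨m, hm, hcm⟩ := hext c₀ hc₀ (fun x hx => by
    obtain ⟨k, s, p, a, b, e, hdom, hint, rfl⟩ := hx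
    exact hNF k s p a b e hdom hint)
  have h₁ := hsound _ hcc₀
  have h₂ := hsound _ hcm
  rw [map_sub] at h₁ h₂
  have hm0 : NumberTheory.Transcendental.KZ.eval m = 0 := by linarith
  have key := add_mem (add_mem hcc₀ hcm) (hKER m hm hm0)
  rwa [sub_add_sub_cancel, sub_add_cancel] at key

end Summit.KontsevichZagierPeriods.KontsevichZagierPeriods.Theses.LinRedNormalForm
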